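import Summits.CriticalPhenomena.PercolationContinuityZ3.Theorems.PercNearOneGluingNoHeavyLowerTailSahiSlotPatternBranching
import Summits.CriticalPhenomena.PercolationContinuityZ3.Theorems.PercNearOneGluingNoHeavyLowerTailSahiSlotPatternSlabs

/-!
# `Φ = 0` exactly on "slabs + the whole cube": the zero locus met by the adversarial minimisers of the open cell `(3,4)`

Support file (lane `prim-masterthm-p3`, generation 18; `--supports stmt-CriticalPhenomena-4575`).  Pure proofs, no definitions,
no `sorry`, standard axioms.

Branching (`patternForm_one_cons_eq`: a constant member `1` contributes `n · Σ_skeletons patternForm(restrictions)`) and the slab zero locus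
(`patternForm_axisSep_eq_zero`), together with the remark that restricting an axis-separated family along a monotone skeleton gives an
axis-separated family on the same axes, yield
  `patternForm_one_cons_axisSep_eq_zero`: `patternForm d (k+3) (1, φ_0(x_{a_0}), …, φ_{k+1}(x_{a_{k+1}})) = 0` for injective `a`,
in particular (`k = 1`, `d = 3`) the order-4 pattern functional of `[4]^3` VANISHES on every quadruple "three one-axis sets on the three
distinct axes + the whole cube" — exactly the configurations (`[2222|…]`, `[4000|…]`, `[4444|4444|0000|0000]`, full cube) on which the
lane's adversarial census of `(3,4)` found its tight minima `Φ = 0` (HIERARCHY §26(l),(q)); by `patternForm_perm_slots` the constant member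
may sit in any slot. [this work]
-/

namespace Summit.CriticalPhenomena.PercolationContinuityZ3.Theorems

open Finset Function Equiv Equiv.Perm
open Literature.Combinatorics.Sahi2008

namespace SahiSlot

section BranchingSlabs

open scoped Classical

variable {d k : ℕ}

/-- **`Φ(1, slabs) = 0`**: a constant member together with `k+2` one-axis functions on distinct axes. [this work] -/
theorem patternForm_one_cons_axisSep_eq_zero (ax : Fin (k + 2) → Fin d) (hax : Injective ax) (φ : Fin (k + 2) → Fin (k + 3) → ℝ) :
    patternForm d (k + 3) (Fin.cons (fun _ => (1 : ℝ)) (fun j (q : Q d (k + 3)) => φ j (q (ax j)))) = 0 := by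
  rw [patternForm_one_cons_eq]
  refine mul_eq_zero_of_right _ (sum_eq_zero fun v _ => ?_)
  -- the restriction along the skeleton `v` is again axis-separated, with `φ'_j = φ_j ∘ v_{a_j}`
  have h := patternForm_axisSep_eq_zero (d := d) (k := k) ax hax (fun j y => φ j (v (ax j) y))
  exact h

/-- The same with the constant member in an arbitrary slot `i`. [this work] -/
theorem patternForm_axisSep_update_one_eq_zero (ax : Fin (k + 2) → Fin d) (hax : Injective ax) (φ : Fin (k + 2) → Fin (k + 3) → ℝ)
    (i : Fin (k + 3)) :
    patternForm d (k + 3) (fun m => (Fin.cons (fun _ => (1 : ℝ)) (fun j (q : Q d (k + 3)) => φ j (q (ax j))) :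
      Fin (k + 3) → Q d (k + 3) → ℝ) (Equiv.swap 0 i m)) = 0 := by
  rw [patternForm_perm_slots, patternForm_one_cons_axisSep_eq_zero ax hax φ]

/-- **At `(3,4)`**: three one-axis indicator sets on the three axes of `[4]^3` plus the whole cube have `patternForm = 0`. [this work] -/
theorem patternForm_three_four_slabs_top_eq_zero (ax : Fin 3 → Fin 3) (hax : Injective ax) (S : Fin 3 → Finset (Fin 4)) :
    patternForm 3 4 (Fin.cons (fun _ => (1 : ℝ)) (fun j => setInd (univ.filter fun q : Q 3 4 => q (ax j) ∈ S j))) = 0 := by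
  have h := patternForm_one_cons_axisSep_eq_zero (d := 3) (k := 1) ax hax (fun j y => if y ∈ S j then (1 : ℝ) else 0)
  convert h using 2
  funext m
  refine Fin.cases ?_ (fun j => ?_) m
  · rfl
  · funext q
    simp [setInd_apply]

end BranchingSlabs

end SahiSlot

end Summit.CriticalPhenomena.PercolationContinuityZ3.Theorems
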